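import Summits.Ventures.PercRepro.ProfileTwoHallBase
import Summits.Ventures.PercRepro.HallDisjointDegreeHall

/-!
# PercRepro — THE HALL FORM (C-033, `H⁺`) OF THE ROW `q = 2`, DIRECTLY: the co-independent pairs have degree `≥ 3`
(p10, gen 5; `proofs/P10-HALLROW.md` §9)

The base case of the Hall row (`ProfileTwoHallBase`) is Hall's condition for disjointness on the CO-INDEPENDENT
PAIRS `𝒞 = coIndepPairs N` of every simple matroid `N` on `u + 2` elements — the pairs `C` with `E ∖ C`
independent.  This family has minimum degree `≥ 3`, uniformly over the nullity of `N`: for `{x, y} ∈ 𝒞` put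
`I := E ∖ {x, y}` (independent, `u` elements) and `J := E ∖ {x} = I ∪ {y}`; the members through `x` other than
`{x, y}` are the `{x, y'}` with `y' ∈ I` and `J ∖ {y'}` independent.  If `J` is independent every `y' ∈ I` works
(`u ≥ 3` of them); otherwise `J` has nullity one and `J ∖ {y'}` is independent exactly when `y'` is not a coloop
of `J` — and a nullity-one set of a simple matroid has at most `#J − 3` coloops (removing the coloops leaves a
set of rank `#J − 1 − #coloops`, which would be a dependent set of size `≤ 2` if `#coloops ≥ #J − 2`).  So at
least `1 + 2 = 3` members pass through `x`, and the degree-only Hall lemma gives the base case for every `u ≥ 3`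
— hence the row `q = 2` of the Hall form for every finite matroid and every level `u > 2`, without the
nullity split (Kneser / meeting-`D` / rank-2 dual) and without the rows `(2, 3)`, `(2, 4)` as inputs.

* `card_coloops_add_three_le_of_simple` — a nullity-one subset of a simple matroid has `≤ #J − 3` coloops;
* `rk_erase_eq_of_notMem_coloops` — erasing a non-coloop keeps the rank;
* `three_le_deg_coIndepPairs` — the degree condition on `coIndepPairs N`;
* `hall_coIndepPairs` — Hall's condition for disjointness on `coIndepPairs N`;
* **`hallIneq_two_all_direct`** — `(H⁺_{2,u})` for every finite matroid and every `u > 2`.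
-/

open scoped Matroid

namespace PercRepro.Cogirth

open Finset ThmH Skew Shadow Profile HallDisjoint

variable {α : Type} [DecidableEq α] {N : Matroid α} [N.Finite]

/-- Removing a set `Y` of coloops of `J` lowers the rank by exactly `#Y` (ℕ form of
`eRk_sdiff_add_card_of_subset_coloops`). -/
theorem rk_sdiff_add_card_of_subset_coloops {J : Finset α} (hJ : J ⊆ gr N) {Y : Finset α}
    (hY : Y ⊆ coloops N J) : rk N (J \ Y) + Y.card = rk N J := by
  have h := eRk_sdiff_add_card_of_subset_coloops (M := N) hJ Y hY
  rw [← coe_rk, ← coe_rk] at h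
  exact_mod_cast h

/-- **A nullity-one subset of a simple matroid has at most `#J − 3` coloops**: its unique circuit has at least
three elements. -/
theorem card_coloops_add_three_le_of_simple (hs : Simple' N) {J : Finset α} (hJ : J ⊆ gr N)
    (hJr : rk N J + 1 = J.card) : (coloops N J).card + 3 ≤ J.card := by
  by_contra hlt
  have hKJ : coloops N J ⊆ J := fun z hz => (mem_coloops.1 hz).1
  have h1 := rk_sdiff_add_card_of_subset_coloops hJ (Subset.refl (coloops N J))
  have hcard : (J \ coloops N J).card = J.card - (coloops N J).card := card_sdiff_of_subset hKJ
  have hKle := card_le_card hKJ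
  -- `J ∖ coloops` has at most two elements, hence is independent of rank equal to its size
  have hsmall : (J \ coloops N J).card ≤ 2 := by omega
  have hind : N.Indep ((J \ coloops N J : Finset α) : Set α) :=
    hs _ (sdiff_subset.trans hJ) hsmall
  have h2 := rk_eq_card_of_indep hind
  omega

/-- Erasing an element that is not a coloop of `J` keeps the rank of `J`. -/
theorem rk_erase_eq_of_notMem_coloops {J : Finset α} (hJ : J ⊆ gr N) {z : α} (hz : z ∈ J)
    (hzc : z ∉ coloops N J) : rk N (J.erase z) = rk N J := by
  have hcl : z ∈ clF N (J.erase z) := by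
    by_contra h
    exact hzc (mem_coloops.2 ⟨hz, h⟩)
  have h := rk_insert_eq (M := N) (hJ hz) (X := J.erase z) ((erase_subset z J).trans hJ)
  rw [insert_erase hz, if_pos hcl] at h
  exact h.symm

/-- `E ∖ {x, y'} = (E ∖ {x}) ∖ {y'}`. -/
theorem sdiff_pair_eq_erase_erase (E : Finset α) (x y' : α) :
    E \ ({x, y'} : Finset α) = (E.erase x).erase y' := by
  rw [sdiff_insert, sdiff_singleton_eq_erase, erase_right_comm]

/-- A pair `{x, y'}` of distinct ground elements of a simple matroid is an independent pair. -/
theorem pair_mem_indepSets_of_simple (hs : Simple' N) {x y' : α} (hx : x ∈ gr N) (hy' : y' ∈ gr N)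
    (hne : x ≠ y') : ({x, y'} : Finset α) ∈ indepSets N 2 := by
  have hsub : ({x, y'} : Finset α) ⊆ gr N := by
    intro z hz
    rw [mem_insert, mem_singleton] at hz
    rcases hz with rfl | rfl
    · exact hx
    · exact hy'
  rw [mem_indepSets]
  exact ⟨hsub, card_pair hne, hs _ hsub (by rw [card_pair hne])⟩

/-- **The degree condition on the co-independent pairs**: on a simple matroid with `u + 2 ≥ 5` elements, every
point of a co-independent pair lies in at least three co-independent pairs. -/
theorem three_le_deg_coIndepPairs (hs : Simple' N) {u : ℕ} (hn : (gr N).card = u + 2) (hu : 3 ≤ u)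
    {C : Finset α} (hC : C ∈ coIndepPairs N) {x : α} (hxC : x ∈ C) : 3 ≤ deg (coIndepPairs N) x := by
  classical
  rw [mem_coIndepPairs, mem_indepSets] at hC
  obtain ⟨⟨hCg, hC2, _⟩, hIind⟩ := hC
  obtain ⟨y, hyC, hyx, hCeq⟩ := exists_other hC2 hxC
  have hx : x ∈ gr N := hCg hxC
  have hy : y ∈ gr N := hCg hyC
  subst hCeq
  -- `I = E ∖ {x, y}`, `J = E ∖ {x}`
  set I := gr N \ ({x, y} : Finset α) with hIdef
  set J := (gr N).erase x with hJdef
  have hJg : J ⊆ gr N := erase_subset x (gr N)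
  have hJcard : J.card = u + 1 := by rw [hJdef, card_erase_of_mem hx, hn]; rfl
  have hIJ : I = J.erase y := sdiff_pair_eq_erase_erase (gr N) x y
  have hyJ : y ∈ J := mem_erase.2 ⟨hyx, hy⟩
  have hIcard : I.card = u := by rw [hIJ, card_erase_of_mem hyJ, hJcard]; rfl
  have hIg : I ⊆ gr N := sdiff_subset
  have hIrk : rk N I = u := by rw [rk_eq_card_of_indep hIind, hIcard]
  -- the candidates: `y' ∈ E ∖ {x}` with `E ∖ {x, y'}` independent
  set S := J.filter (fun y' => N.Indep ((gr N \ ({x, y'} : Finset α) : Finset α) : Set α)) with hSdef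
  have hyS : y ∈ S := mem_filter.2 ⟨hyJ, hIind⟩
  -- `y' ∈ I` with `J ∖ {y'}` independent is a candidate
  have hcand : ∀ y' ∈ I, N.Indep ((J.erase y' : Finset α) : Set α) → y' ∈ S := by
    intro y' hy' hind
    rw [hIJ] at hy'
    refine mem_filter.2 ⟨(mem_erase.1 hy').2, ?_⟩
    rw [sdiff_pair_eq_erase_erase]
    exact hind
  -- at least two elements of `I` are candidates
  have htwo : 2 ≤ (I.filter (fun y' => y' ∈ S)).card := by
    have hrkJ : rk N J ≤ u + 1 := by rw [← hJcard]; exact rk_le_card J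
    have hrkJ' : u ≤ rk N J := by rw [← hIrk]; exact rk_mono' (by rw [hIJ]; exact erase_subset y J)
    rcases Nat.lt_or_ge (rk N J) (u + 1) with hlt | hge
    · -- nullity one: the non-coloops of `J` inside `I`
      have hJr : rk N J + 1 = J.card := by omega
      have hcol := card_coloops_add_three_le_of_simple hs hJg hJr
      have hsub : I \ coloops N J ⊆ I.filter (fun y' => y' ∈ S) := by
        intro y' hy'
        rw [mem_sdiff] at hy'
        refine mem_filter.2 ⟨hy'.1, hcand y' hy'.1 ?_⟩
        have hy'J : y' ∈ J := by rw [hIJ] at hy'; exact (mem_erase.1 hy'.1).2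
        apply indep_of_rk_eq_card
        rw [rk_erase_eq_of_notMem_coloops hJg hy'J hy'.2, card_erase_of_mem hy'J]
        omega
      have h1 := card_le_card hsub
      have h2 := le_card_sdiff (coloops N J) I
      omega
    · -- `J` independent: every `y' ∈ I` is a candidate
      have hJind : N.Indep (J : Set α) := indep_of_rk_eq_card (by omega)
      have hsub : I ⊆ I.filter (fun y' => y' ∈ S) := by
        intro y' hy'
        refine mem_filter.2 ⟨hy', hcand y' hy' (hJind.subset ?_)⟩
        exact_mod_cast erase_subset y' J
      have h1 := card_le_card hsub
      omega
  -- `S` contains `y` and the candidates of `I` (`y ∉ I`)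
  have hyI : y ∉ I := by
    rw [hIJ]
    exact fun h => (mem_erase.1 h).1 rfl
  have hS3 : 3 ≤ S.card := by
    have hsub : insert y (I.filter (fun y' => y' ∈ S)) ⊆ S := by
      intro z hz
      rw [mem_insert] at hz
      rcases hz with rfl | hz
      · exact hyS
      · exact (mem_filter.1 hz).2
    have h1 := card_le_card hsub
    rw [card_insert_of_notMem (fun h => hyI (mem_filter.1 h).1)] at h1
    omega
  -- `y' ↦ {x, y'}` injects `S` into the co-independent pairs through `x`
  have hinj : S.card ≤ ((coIndepPairs N).filter (fun D => x ∈ D)).card := by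
    apply card_le_card_of_injOn (fun y' => ({x, y'} : Finset α))
    · intro y' hy'
      rw [Finset.mem_coe, mem_filter] at hy'
      have hy'x : x ≠ y' := fun h => (mem_erase.1 hy'.1).1 h.symm
      rw [Finset.mem_coe, mem_filter, mem_coIndepPairs]
      exact ⟨⟨pair_mem_indepSets_of_simple hs hx (hJg hy'.1) hy'x, hy'.2⟩, mem_insert_self x {y'}⟩
    · intro y' hy' y'' hy'' h
      rw [Finset.mem_coe, mem_filter] at hy' hy''
      have hy''x : y'' ≠ x := (mem_erase.1 hy''.1).1
      have : y' ∈ ({x, y''} : Finset α) := by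
        simp only at h
        rw [← h]
        exact mem_insert_of_mem (mem_singleton_self y')
      rw [mem_insert, mem_singleton] at this
      rcases this with h' | h'
      · exact absurd h' (mem_erase.1 hy'.1).1
      · exact h'
  unfold deg
  omega

/-- **Hall's condition for disjointness on the co-independent pairs** of a simple matroid on `u + 2 ≥ 5`
elements, for every family. -/
theorem hall_coIndepPairs (hs : Simple' N) {u : ℕ} (hn : (gr N).card = u + 2) (hu : 3 ≤ u)
    {𝒜 : Finset (Finset α)} (h𝒜 : 𝒜 ⊆ coIndepPairs N) : 𝒜.card ≤ (nbr (coIndepPairs N) 𝒜).card :=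
  hall_disjoint_of_degree (fun _ hC => (mem_indepSets.1 (mem_coIndepPairs.1 hC).1).2.1)
    (fun _ hC _ hxC => three_le_deg_coIndepPairs hs hn hu hC hxC) h𝒜

/-- **THE ROW `q = 2` OF THE HALL FORM (C-033) FOR EVERY FINITE MATROID, EVERY LEVEL `u > 2` AND EVERY FAMILY
OF RANK-2 SETS** — directly from the base-case translation and the degree-only Hall lemma. -/
theorem hallIneq_two_all_direct {u : ℕ} (hu : 2 < u) (M : Matroid α) [M.Finite] : HallIneq M 2 u :=
  hallIneq_two_all_of_hall_disjoint hu (fun N _ hs hn 𝒜 h𝒜 => hall_coIndepPairs hs hn (by omega) h𝒜) M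

end PercRepro.Cogirth
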